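import Summits.AtomisticToContinuum.BoseEinsteinCondensation.Theorems.FibreConductance.Negative.SlabGradientDefect

/-!
# Crux `FibreConductance` (stmt-AtomisticToContinuum-9480) — negative-side toolkit: the pairing of
the slab's gradient charge `ε♭` with the chamber-selector test function

Refuter (drefute) support file for stub 4 `GradientComparability` of the line
`parseval-shell-bootstrap`.  With `ε♭ = -iL^{-3/2}(L/2π)e^{iθ(x₀₀)}G'(x₀₀)` (`SlabGradientDefect.lean`)
and the disprover's test function `η = f(x₀₀)∏_{j≠0}φ(xⱼ)²` (`TestFunction.lean`, `f` = chamber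
selector): `∫ ε♭ η = L^{-3/2}(L/2π)(-i)·L²∫₀ᴸ e^{iθ}G'f` (`gradPairing_eq`); integration by parts on
the period, `∫₀ᴸ e^{iθ}G'f = -(2πi/L)∫₀ᴸ e^{iθ}Gf - ∫₀ᴸ e^{iθ}Gf'` (`intervalIntegral_gradPairingFun`),
turns it into MINUS the disprover's chamber pairing (`‖·‖ ≥ 1/16`, `norm_pairing_ge`) plus an
`f'`-term supported where `g = σ` (`‖·‖ ≤ 4πKσ/√Z`, `norm_integral_slabG_deriv_testProfile_le`);
hence `‖∫ ε♭ η‖ ≥ 1/16 - 4Kσ` (`norm_gradPairing_ge`).  All [folklore].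
-/

noncomputable section

namespace Summit.AtomisticToContinuum.BoseEinsteinCondensation.Theorems.FibreConductance.Negative

open MeasureTheory Literature.MathematicalPhysics.QuantumManyBody.BoseGas Real
open Summit.AtomisticToContinuum.BoseEinsteinCondensation.Theorems.GaussianDominationCan.Negative
open scoped ENNReal NNReal

variable {m : ℕ} {L σ : ℝ}

/-! ### The pairing of `ε♭` with the chamber-selector test function `η` -/

section Pairing

open intervalIntegral

/-- The one-dimensional pairing integrand `e^{iθ} G' f`. -/
def gradPairingFun (L σ t : ℝ) : ℂ :=
  Complex.exp ((ang L t : ℂ) * Complex.I) * ((deriv (slabG L σ) t * testProfile L t : ℝ) : ℂ)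

/-- **The pairing of `ε♭` with `η = f(x₀₀)∏_{j≠0}φ(xⱼ)²`**:
`∫ ε♭ η = L^{-3/2} (L/2π)(-i) · L² ∫₀ᴸ e^{iθ} G' f`. [folklore] -/
theorem gradPairing_eq (hL : 0 < L) (hσ0 : 0 < σ) (hσ1 : σ ≤ 1) :
    ∫ X in cellN (m + 1) L, gradDefect L e0 (realProd m (slabFactor L σ)) X * eta m L σ X =
      ((Real.sqrt (L ^ 3))⁻¹ : ℂ) * ((((L / (2 * π) : ℝ)) : ℂ) * (-Complex.I)) *
        (((L : ℂ) ^ 2) * ∫ t in (0 : ℝ)..L, gradPairingFun L σ t) := by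
  set F := etaFactors m L σ with hF
  set c : ℂ := (((L / (2 * π) : ℝ)) : ℂ) * (-Complex.I) with hc
  set h : Space → ℂ := fun y =>
    wave L e0 y * (((deriv (slabG L σ) (y 0) : ℝ)) : ℂ) * F 0 y with hh
  have hpt : ∀ X : Config (m + 1),
      gradDefect L e0 (realProd m (slabFactor L σ)) X * eta m L σ X =
        ((Real.sqrt (L ^ 3))⁻¹ : ℂ) * c * prodFun (Function.update F 0 h) X := by
    intro X
    rw [gradDefect_slab hL hσ0 hσ1, eta, prodFun_update_fun, ← hF, prodFun_eq_mul_erase F 0 X, hh, hc]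
    push_cast
    ring
  simp_rw [hpt]
  rw [MeasureTheory.integral_const_mul]
  congr 1
  have hprod : ∫ X in cellN (m + 1) L, prodFun (Function.update F 0 h) X =
      ∏ j, ∫ y in cell L, Function.update F 0 h j y := integral_cellN_prod _
  have hupd : ∀ j, (∫ y in cell L, Function.update F 0 h j y) =
      Function.update (fun j => ∫ y in cell L, F j y) 0 (∫ y in cell L, h y) j := fun j =>
    Function.apply_update (fun _ (g : Space → ℂ) => ∫ y in cell L, g y) F 0 h j
  rw [hprod]
  simp_rw [hupd]
  rw [Finset.prod_update_of_mem (Finset.mem_univ _), Finset.sdiff_singleton_eq_erase]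
  have hones : ∀ j ∈ Finset.univ.erase (0 : Fin (m + 1)), ∫ y in cell L, F j y = 1 := by
    intro j hj
    simp_rw [hF, etaFactors_of_ne_apply (Finset.ne_of_mem_erase hj)]
    exact integral_sq_slabFactor_complex hL hσ0.le hσ1
  rw [Finset.prod_congr rfl hones, Finset.prod_const_one, mul_one]
  have hh1 : ∀ y : Space, h y = gradPairingFun L σ (y 0) := by
    intro y
    rw [hh, hF, etaFactors_zero]
    simp only [gradPairingFun, wave_e0, axisFun]
    rw [mul_comm (Complex.I) _]
    push_cast
    ring
  simp_rw [hh1]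
  rw [integral_cell_comp_coord0 hL.le (gradPairingFun L σ), setIntegral_Ico_eq_intervalIntegral hL.le]

/-- **Integration by parts on the period**: `∫₀ᴸ e^{iθ}G'f = -(2πi/L)∫₀ᴸ e^{iθ}Gf - ∫₀ᴸ e^{iθ}Gf'`
(the boundary terms cancel by periodicity). [folklore] -/
theorem intervalIntegral_gradPairingFun (hL : 0 < L) (σ : ℝ) :
    ∫ t in (0 : ℝ)..L, gradPairingFun L σ t =
      -((((2 * π / L : ℝ)) : ℂ) * Complex.I * ∫ t in (0 : ℝ)..L, pairingFun L σ t) -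
        ∫ t in (0 : ℝ)..L, Complex.exp ((ang L t : ℂ) * Complex.I) *
          ((slabG L σ t * deriv (testProfile L) t : ℝ) : ℂ) := by
  set u : ℝ → ℂ := fun t => Complex.exp ((ang L t : ℂ) * Complex.I) * ((testProfile L t : ℝ) : ℂ)
    with hu
  set u' : ℝ → ℂ := fun t => Complex.exp ((ang L t : ℂ) * Complex.I) * ((((2 * π / L : ℝ)) : ℂ) *
    Complex.I) * ((testProfile L t : ℝ) : ℂ) +
      Complex.exp ((ang L t : ℂ) * Complex.I) * ((deriv (testProfile L) t : ℝ) : ℂ) with hu'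
  set v : ℝ → ℂ := fun t => ((slabG L σ t : ℝ) : ℂ) with hv
  set v' : ℝ → ℂ := fun t => ((deriv (slabG L σ) t : ℝ) : ℂ) with hv'
  have hdf : Differentiable ℝ (testProfile L) := (contDiff_testProfile L).differentiable one_ne_zero
  have hdG : Differentiable ℝ (slabG L σ) := (contDiff_slabG L σ).differentiable one_ne_zero
  have hcf' : Continuous (deriv (testProfile L)) := (contDiff_testProfile L).continuous_deriv le_rfl
  have hcG' : Continuous (deriv (slabG L σ)) := (contDiff_slabG L σ).continuous_deriv le_rfl
  have hexp : ∀ t, HasDerivAt (fun t => Complex.exp ((ang L t : ℂ) * Complex.I))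
      (Complex.exp ((ang L t : ℂ) * Complex.I) * ((((2 * π / L : ℝ)) : ℂ) * Complex.I)) t :=
    fun t => ((hasDerivAt_ang L t).ofReal_comp.mul_const Complex.I).cexp
  have hud : ∀ t, HasDerivAt u (u' t) t := fun t =>
    (hexp t).fun_mul (hdf t).hasDerivAt.ofReal_comp
  have hvd : ∀ t, HasDerivAt v (v' t) t := fun t => (hdG t).hasDerivAt.ofReal_comp
  have hcexp : Continuous fun t => Complex.exp ((ang L t : ℂ) * Complex.I) :=
    Complex.continuous_exp.comp ((Complex.continuous_ofReal.comp (contDiff_ang L).continuous).mul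
      continuous_const)
  have hcu' : Continuous u' := by
    rw [hu']
    exact ((hcexp.mul continuous_const).mul (Complex.continuous_ofReal.comp
      (contDiff_testProfile L).continuous)).add (hcexp.mul (Complex.continuous_ofReal.comp hcf'))
  have hcv' : Continuous v' := Complex.continuous_ofReal.comp hcG'
  have hibp := integral_mul_deriv_eq_deriv_mul (fun t _ => hud t) (fun t _ => hvd t)
    (hcu'.intervalIntegrable 0 L) (hcv'.intervalIntegrable 0 L)
  -- the integrand is `u v'`
  have hint : ∀ t, gradPairingFun L σ t = u t * v' t := fun t => by
    simp only [gradPairingFun, hu, hv']; push_cast; ring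
  simp_rw [hint]
  rw [hibp]
  -- boundary terms cancel
  have hb : u L * v L - u 0 * v 0 = 0 := by
    simp only [hu, hv]
    have h1 : ang L L = 2 * π := by unfold ang; field_simp
    have h2 : ang L 0 = 0 := by unfold ang; simp
    have h3 : testProfile L L = testProfile L 0 := by
      have := testProfile_add_period hL.ne' 0; rwa [zero_add] at this
    have h4 : slabG L σ L = slabG L σ 0 := by
      have := slabG_add_period (σ := σ) hL.ne' 0; rwa [zero_add] at this
    rw [h1, h2, h3, h4]
    push_cast
    rw [Complex.exp_mul_I, zero_mul, Complex.exp_zero, Complex.cos_two_pi, Complex.sin_two_pi]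
    ring
  rw [hb, zero_sub]
  -- split `∫ u' v`
  have hc1 : Continuous fun t => Complex.exp ((ang L t : ℂ) * Complex.I) * ((((2 * π / L : ℝ)) : ℂ) *
      Complex.I) * ((testProfile L t : ℝ) : ℂ) * v t :=
    ((hcexp.mul continuous_const).mul (Complex.continuous_ofReal.comp
      (contDiff_testProfile L).continuous)).mul (Complex.continuous_ofReal.comp (contDiff_slabG L σ).continuous)
  have hc2 : Continuous fun t => Complex.exp ((ang L t : ℂ) * Complex.I) *
      ((deriv (testProfile L) t : ℝ) : ℂ) * v t :=
    (hcexp.mul (Complex.continuous_ofReal.comp hcf')).mul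
      (Complex.continuous_ofReal.comp (contDiff_slabG L σ).continuous)
  have hsplit : ∀ t, u' t * v t =
      Complex.exp ((ang L t : ℂ) * Complex.I) * ((((2 * π / L : ℝ)) : ℂ) * Complex.I) *
          ((testProfile L t : ℝ) : ℂ) * v t +
        Complex.exp ((ang L t : ℂ) * Complex.I) * ((deriv (testProfile L) t : ℝ) : ℂ) * v t := fun t => by
    simp only [hu']; ring
  simp_rw [hsplit]
  rw [intervalIntegral.integral_add (hc1.intervalIntegrable 0 L) (hc2.intervalIntegrable 0 L)]
  have e1 : ∫ t in (0 : ℝ)..L, Complex.exp ((ang L t : ℂ) * Complex.I) * ((((2 * π / L : ℝ)) : ℂ) *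
      Complex.I) * ((testProfile L t : ℝ) : ℂ) * v t =
      (((2 * π / L : ℝ)) : ℂ) * Complex.I * ∫ t in (0 : ℝ)..L, pairingFun L σ t := by
    rw [← intervalIntegral.integral_const_mul]
    refine intervalIntegral.integral_congr fun t _ => ?_
    simp only [pairingFun, hv]; push_cast; ring
  have e2 : ∫ t in (0 : ℝ)..L, Complex.exp ((ang L t : ℂ) * Complex.I) *
      ((deriv (testProfile L) t : ℝ) : ℂ) * v t =
      ∫ t in (0 : ℝ)..L, Complex.exp ((ang L t : ℂ) * Complex.I) *
        ((slabG L σ t * deriv (testProfile L) t : ℝ) : ℂ) := by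
    refine intervalIntegral.integral_congr fun t _ => ?_
    simp only [hv]; push_cast; ring
  rw [e1, e2]
  ring

/-- **The `f'`-term is small**: `‖∫₀ᴸ e^{iθ} G f'‖ ≤ 4πKσ/√Z` (`f' ≠ 0` only where `g = σ`).
[folklore] -/
theorem norm_integral_slabG_deriv_testProfile_le (hL : 0 < L) (hσ0 : 0 < σ) (hσ1 : σ ≤ 1) {K : ℝ}
    (hK : ∀ x, |deriv smoothTransition x| ≤ K) :
    ‖∫ t in (0 : ℝ)..L, Complex.exp ((ang L t : ℂ) * Complex.I) *
        ((slabG L σ t * deriv (testProfile L) t : ℝ) : ℂ)‖ ≤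
      4 * π * K * σ / Real.sqrt (slabZ L σ) := by
  have hZ := slabZ_pos hL hσ0.le hσ1
  have hK0 : 0 ≤ K := (abs_nonneg _).trans (hK 0)
  have hpt : ∀ t ∈ Set.uIoc (0 : ℝ) L, ‖Complex.exp ((ang L t : ℂ) * Complex.I) *
      ((slabG L σ t * deriv (testProfile L) t : ℝ) : ℂ)‖ ≤ σ / Real.sqrt (slabZ L σ) * (4 * π * K / L) := by
    intro t _
    rw [norm_mul, Complex.norm_exp_ofReal_mul_I, one_mul, Complex.norm_real, Real.norm_eq_abs, abs_mul]
    by_cases hft : deriv (testProfile L) t = 0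
    · rw [hft, abs_zero, mul_zero]; positivity
    · have hs : |sin (ang L t)| ≤ 1 / 2 :=
        (abs_sin_le_of_deriv_testProfile_ne_zero hft).trans (by norm_num)
      have hG : slabG L σ t = σ / Real.sqrt (slabZ L σ) := by
        unfold slabG; rw [slabProfile_eq_of_abs_sin_le hs]
      rw [hG, abs_of_pos (by positivity)]
      exact mul_le_mul_of_nonneg_left (abs_deriv_testProfile_le hL hK t) (by positivity)
  have h := intervalIntegral.norm_integral_le_of_norm_le_const hpt
  rw [sub_zero, abs_of_pos hL] at h
  refine h.trans (le_of_eq ?_)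
  field_simp

end Pairing

/-! ### Lower bound on the pairing -/

section LowerBound

open intervalIntegral

/-- **The pairing of `ε♭` with `η` is bounded below**: `‖∫ ε♭ η‖ ≥ 1/16 - 4Kσ` — it is minus the
disprover's chamber pairing (`≥ 1/16`, `norm_pairing_ge`) up to the `f'`-term (`≤ 4Kσ`). [folklore] -/
theorem norm_gradPairing_ge (hL : 0 < L) (hσ0 : 0 < σ) (hσ : σ ≤ 1 / 3) {K : ℝ}
    (hK : ∀ x, |deriv smoothTransition x| ≤ K) :
    1 / 16 - 4 * K * σ ≤
      ‖∫ X in cellN (m + 1) L, gradDefect L e0 (realProd m (slabFactor L σ)) X * eta m L σ X‖ := by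
  have hσ1 : σ ≤ 1 := hσ.trans (by norm_num)
  have hL3 : 0 < L ^ 3 := by positivity
  have hZ := slabZ_pos hL hσ0.le hσ1
  have hZb := (slabZ_bounds hL hσ0.le hσ1).1
  have hK0 : 0 ≤ K := (abs_nonneg _).trans (hK 0)
  set P₁ : ℂ := ∫ t in (0 : ℝ)..L, pairingFun L σ t with hP₁
  set P₂ : ℂ := ∫ t in (0 : ℝ)..L, Complex.exp ((ang L t : ℂ) * Complex.I) *
    ((slabG L σ t * deriv (testProfile L) t : ℝ) : ℂ) with hP₂
  set A : ℂ := ∫ X in cellN (m + 1) L, fibreCharge L e0 (realProd m (slabFactor L σ)) X * eta m L σ X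
    with hA
  have hAeq : A = ((Real.sqrt (L ^ 3))⁻¹ : ℂ) * (((L : ℂ) ^ 2) * P₁) := pairing_eq hL hσ0 hσ1
  set B : ℂ := ((Real.sqrt (L ^ 3))⁻¹ : ℂ) * ((((L / (2 * π) : ℝ)) : ℂ) * (-Complex.I)) *
    (((L : ℂ) ^ 2) * P₂) with hB
  -- the value of the pairing
  have hval : ∫ X in cellN (m + 1) L, gradDefect L e0 (realProd m (slabFactor L σ)) X * eta m L σ X =
      -A - B := by
    rw [gradPairing_eq hL hσ0 hσ1, intervalIntegral_gradPairingFun hL σ, ← hP₁, ← hP₂, hAeq, hB]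
    have hI : Complex.I * Complex.I = -1 := Complex.I_mul_I
    have hr : (((L / (2 * π) : ℝ)) : ℂ) * (((2 * π / L : ℝ)) : ℂ) = 1 := by
      rw [← Complex.ofReal_mul]
      rw [show L / (2 * π) * (2 * π / L) = 1 by field_simp]
      simp
    linear_combination (((Real.sqrt (L ^ 3))⁻¹ : ℂ) * (L : ℂ) ^ 2 * P₁ *
      (((L / (2 * π) : ℝ)) : ℂ) * (((2 * π / L : ℝ)) : ℂ)) * hI -
      ((Real.sqrt (L ^ 3))⁻¹ : ℂ) * (L : ℂ) ^ 2 * P₁ * hr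
  -- sizes
  have hAge : 1 / 16 ≤ ‖A‖ := norm_pairing_ge (m := m) hL hσ0 hσ
  have hP₂le := norm_integral_slabG_deriv_testProfile_le hL hσ0 hσ1 hK
  rw [← hP₂] at hP₂le
  have hsq : L ^ 3 / 2 ≤ Real.sqrt (L ^ 3) * Real.sqrt (slabZ L σ) := by
    rw [← Real.sqrt_mul hL3.le]
    calc L ^ 3 / 2 = Real.sqrt ((L ^ 3 / 2) ^ 2) := (Real.sqrt_sq (by positivity)).symm
      _ ≤ Real.sqrt (L ^ 3 * slabZ L σ) := Real.sqrt_le_sqrt (by nlinarith)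
  have hBle : ‖B‖ ≤ 4 * K * σ := by
    rw [hB, norm_mul, norm_mul, norm_mul, norm_mul, norm_neg, Complex.norm_I, mul_one,
      ← Complex.ofReal_inv, Complex.norm_real, Real.norm_of_nonneg (by positivity), Complex.norm_real,
      Real.norm_of_nonneg (by positivity), norm_pow, Complex.norm_real, Real.norm_of_nonneg hL.le]
    calc (Real.sqrt (L ^ 3))⁻¹ * (L / (2 * π)) * (L ^ 2 * ‖P₂‖)
        ≤ (Real.sqrt (L ^ 3))⁻¹ * (L / (2 * π)) * (L ^ 2 * (4 * π * K * σ / Real.sqrt (slabZ L σ))) := by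
          gcongr
      _ = 2 * K * σ * (L ^ 3 / (Real.sqrt (L ^ 3) * Real.sqrt (slabZ L σ))) := by
          field_simp
          ring
      _ ≤ 2 * K * σ * 2 := by
          gcongr
          rw [div_le_iff₀ (by positivity)]
          linarith
      _ = 4 * K * σ := by ring
  rw [hval]
  have htri : ‖A‖ ≤ ‖-A - B‖ + ‖B‖ := by
    have := norm_sub_le (-A - B) (-B)
    have e : -A - B - -B = -A := by ring
    rw [e, norm_neg, norm_neg] at this
    exact this
  linarith

end LowerBound

end Summit.AtomisticToContinuum.BoseEinsteinCondensation.Theorems.FibreConductance.Negative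

end
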